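import Literature.Geometry.Riemannian.HamiltonImageLieSubalgebra
import HarnessLib

/-!
# Hamilton 1986, §9: the Lie subalgebras of `so(4) = so(3) × so(3)` by dimension
(topic `Geometry/Riemannian`)

A brick of the printed proof of the named fact
`Literature.Geometry.Riemannian.hamilton_nonnegCurvatureOperator_classification_four`
(`HamiltonNCOClassification.lean`; R. S. Hamilton, *Four-manifolds with positive curvature
operator*, J. Differential Geom. 24 (1986), **Thm. 1.3**, p. 154), continuing
`HamiltonImageLieSubalgebra.lean` (Thm. 8.3, pointwise: the image `𝔤 = Im M` of the curvature
operator is a Lie subalgebra of `so(4) = Λ²₊ ⊕ Λ²₋ ≅ so(3) × so(3)`, the bracket being the cross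
product in each factor, `HamiltonODE.bracket`). §9 of the paper (p. 178) then announces "Here are
the possibilities in dimension 4, classified by the holonomy group" and lists
`𝔤 = {1}`, `so(2)`, `so(2) × so(2)`, `so(3)`, `so(3) × so(2)`, `so(3) × so(3)` (cases 1–6), using
along the way (verbatim): "The only Lie subalgebras of `so(3)` are `{0}`, `so(3)` itself, and any
one-dimensional subspace" (p. 176); case 3: "In this case there are two invariant 2-forms `φ ∈ Λ²₊`
and `ψ ∈ Λ²₋`"; case 4: "Note again `𝔤` cannot be just one factor of `so(3) × so(3)` by the
Bianchi identity. In fact, since any Lie algebra preserving map of `so(3)` to `so(3)` must be a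
multiple of the identity, and since `tr A = tr C`, we see that `𝔤` embeds as `{φ + Pφ}`, where
`P` is an isometry of `Λ²₊` to `Λ²₋`"; case 5: "Each Lie algebra preserving map `so(3) → so(3)`
and `so(2) → so(3)` is either zero or an isometry. It follows that `so(3)` maps to one factor in
`so(3) × so(3)` and `so(2)` maps into the other" (p. 179).

This file PROVES the classification of the subalgebras `𝔥 ⊂ so(3) × so(3)` by dimension that
these sentences rely on, for an arbitrary subspace `𝔥 : Submodule ℝ (ℝ³ × ℝ³)` closed under
`HamiltonODE.bracket` (theorems only; no definitions, no named facts). Write `π₁(𝔥)`, `π₂(𝔥)`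
for the projections (`𝔥.map (LinearMap.fst …)`, `𝔥.map (LinearMap.snd …)`) and
`K₁ = {x | (x, 0) ∈ 𝔥}`, `K₂ = {y | (0, y) ∈ 𝔥}` (`𝔥.comap (LinearMap.inl …)`,
`𝔥.comap (LinearMap.inr …)`); all four are subalgebras of `(ℝ³, ×)`, `Kᵢ` is an ideal of `πᵢ(𝔥)`,
and `dim 𝔥 = dim π₁(𝔥) + dim K₂ = dim π₂(𝔥) + dim K₁` (rank–nullity):

* `finrank_eq_zero_or_one_or_three_of_cross_mem` — subalgebras of `(ℝ³, ×)` have dimension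
  `0`, `1` or `3` (p. 176; from `finrank_ne_two_of_cross_mem`); `false_of_finrank_eq_one_of_cross_mem`
  — `(ℝ³, ×)` has no one-dimensional ideal.
* `finrank_eq_finrank_map_fst_add`, `finrank_eq_finrank_map_snd_add` — the two rank–nullity
  identities; `cross_mem_map_fst/snd`, `cross_mem_comap_inl/inr` — the closure properties.
* `finrank_ne_five` — **there is no five-dimensional subalgebra**, so the printed list of
  dimensions `0, 1, 2, 3, 4, 6` is exhaustive (not spelled out in the paper).
* `fst_le_or_snd_le_of_finrank_eq_four` — **`dim 𝔥 = 4` ⇒ `𝔥 ⊃ so(3) × 0` or `𝔥 ⊃ 0 × so(3)`**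
  (case 5: "`so(3)` maps to one factor … and `so(2)` maps into the other").
* `eq_factor_or_graph_of_finrank_eq_three` — **`dim 𝔥 = 3` ⇒ `𝔥 = so(3) × 0`, or `0 × so(3)`,
  or the graph `{(x, Px)}` of a special orthogonal `P`** (case 4: "`𝔤` embeds as `{φ + Pφ}`
  where `P` is an isometry"; the Lie-algebra input is `eq_zero_or_isometry_of_map_cross` of
  `HamiltonImageLieSubalgebra.lean`). For `𝔤 = Im M` with `tr A = tr C` the two factor cases
  are excluded by `eq_zero_of_forall_act_snd_eq_zero` / `…_fst_…` there.
* `eq_span_pair_of_finrank_eq_two` — **`dim 𝔥 = 2` ⇒ `𝔥 = ℝ(φ, 0) ⊕ ℝ(0, ψ)`** with `φ, ψ ≠ 0`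
  (case 3: "two invariant 2-forms `φ ∈ Λ²₊` and `ψ ∈ Λ²₋`").
* `hamilton_caseList` — **the printed case list for the curvature operator at a point**: for
  `M = (A B; ᵗB C) ≥ 0` with `A`, `C` symmetric, `tr A = tr C` and `null M ⊂ null M^#` (Lemma
  8.2 / Thm. 8.3), writing `𝔤 = Im M = LinearMap.range (actₗ p)`: `M = 0`; or `dim 𝔤 = 1` and
  `𝔤 = ℝθ` with `|θ₊| = |θ₋|` (case 2); or `dim 𝔤 = 2` and `𝔤 = ℝ(φ,0) ⊕ ℝ(0,ψ)` (case 3); or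
  `dim 𝔤 = 3` and `𝔤` is the graph of a special orthogonal `P` (case 4; the factors being excluded
  by `tr A = tr C`, `eq_zero_of_forall_act_snd/fst_eq_zero`); or `dim 𝔤 = 4` and `𝔤 ⊃` a factor
  (case 5); or `M > 0` (case 6) — with `finrank_range_actₗ_ne_five`,
  `quad_pos_of_finrank_range_actₗ_eq_six`; and `hamilton_caseList_frame`, the same list in the
  frame convention of `CurvatureDecomposition.lean` (null-space hypothesis
  `M v = 0 ⇒ ᵗx A^# x - 2 ᵗx B^# y + ᵗy C^# y = 0`; graph isometry of determinant `-1`).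

Conventions: `bracket` is the bracket of Hamilton's PRINTED convention (see the caveat in
`HamiltonImageLieSubalgebra.lean`); for the frame convention of `CurvatureDecomposition.lean`
(bracket `(x × x', -(y × y'))`) apply the statements to the reflected subspace
`{(x, -y) : (x, y) ∈ 𝔥}` — closedness is exchanged by the reflection `flipSnd`, the conclusions
are reflection-invariant except that the graph isometry `P` of case 4 becomes `-P`, orthogonal of
determinant `-1` (e.g. `Λ²(e₀^⊥) = {x + y = 0}`).

Not here: the identification of these algebraic cases with the geometric ones (splitting lemma,
Kähler structure, Thm. 1.1), which is the analytic part of §9.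

## References

* R. S. Hamilton, *Four-manifolds with positive curvature operator*, J. Differential Geom. 24
  (1986) 153–179, §9, p. 176 (subalgebras of `so(3)`), pp. 178–179 (cases 1–6). [Hamilton1986]
-/

noncomputable section

open Matrix Finset
open scoped BigOperators

namespace Literature.Geometry.Riemannian

namespace HamiltonODE

/-! ### §9, p. 178: the Lie subalgebras of `so(4) = so(3) × so(3)` by dimension -/

section Subalgebras

open Module

variable (h : Submodule ℝ ((Fin 3 → ℝ) × (Fin 3 → ℝ)))

/-- The subalgebras of `(ℝ³, ×)` have dimension `0`, `1` or `3` ("The only Lie subalgebras of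
`so(3)` are `{0}`, `so(3)` itself, and any one-dimensional subspace", Hamilton 1986, §9, p. 176).
[cite: Hamilton1986, §9, p. 176] -/
theorem finrank_eq_zero_or_one_or_three_of_cross_mem (W : Submodule ℝ (Fin 3 → ℝ))
    (hW : ∀ a ∈ W, ∀ b ∈ W, a ⨯₃ b ∈ W) :
    finrank ℝ W = 0 ∨ finrank ℝ W = 1 ∨ finrank ℝ W = 3 := by
  have h3 : finrank ℝ W ≤ 3 := by
    have := W.finrank_le
    rwa [finrank_fin_fun] at this
  have h2 := finrank_ne_two_of_cross_mem W hW
  omega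

/-- `(ℝ³, ×)` has no one-dimensional ideal: if `k × y ∈ ℝ k` for all `y` then `k = 0` (take
`y = e₀, e₁`). [folklore] -/
theorem eq_zero_of_forall_cross_mem_span (k : Fin 3 → ℝ) (hk : ∀ y, ∃ c : ℝ, k ⨯₃ y = c • k) :
    k = 0 := by
  have key : ∀ y, k ⨯₃ y = 0 := by
    intro y
    obtain ⟨c, hc⟩ := hk y
    rw [← dotProduct_self_eq_zero]
    conv_lhs => arg 2; rw [hc]
    rw [dotProduct_smul, dotProduct_comm, dot_self_cross, smul_zero]
  have h0 := key (Pi.single 0 1)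
  have h1 := key (Pi.single 1 1)
  rw [cross_apply] at h0 h1
  simp only [Pi.single_apply] at h0 h1
  simp only [Fin.isValue, one_ne_zero, ↓reduceIte, mul_zero, mul_one, zero_sub, sub_zero,
    Fin.reduceEq] at h0 h1
  have k1 : k 1 = 0 := by simpa using congr_fun h0 2
  have k2 : k 2 = 0 := by simpa using congr_fun h0 1
  have k0 : k 0 = 0 := by simpa using congr_fun h1 2
  ext i
  fin_cases i <;> assumption

/-- A one-dimensional subspace `K` of `(ℝ³, ×)` with `K × ℝ³ ⊂ K` does not exist. [folklore] -/
theorem false_of_finrank_eq_one_of_cross_mem (K : Submodule ℝ (Fin 3 → ℝ))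
    (h1 : finrank ℝ K = 1) (hK : ∀ x ∈ K, ∀ y, x ⨯₃ y ∈ K) : False := by
  obtain ⟨⟨k, hkK⟩, hk0, hgen⟩ := finrank_eq_one_iff'.1 h1
  have hk : ∀ y, ∃ c : ℝ, k ⨯₃ y = c • k := by
    intro y
    obtain ⟨c, hc⟩ := hgen ⟨k ⨯₃ y, hK k hkK y⟩
    exact ⟨c, by simpa using congrArg Subtype.val hc.symm⟩
  exact hk0 (Subtype.ext (eq_zero_of_forall_cross_mem_span k hk))

variable {h}

/-- The projection of a subalgebra of `so(3) × so(3)` to the first factor is a subalgebra of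
`so(3)`. [folklore] -/
theorem cross_mem_map_fst (hh : ∀ u ∈ h, ∀ w ∈ h, bracket u w ∈ h)
    (a : Fin 3 → ℝ) (ha : a ∈ h.map (LinearMap.fst ℝ _ _)) (b : Fin 3 → ℝ)
    (hb : b ∈ h.map (LinearMap.fst ℝ _ _)) : a ⨯₃ b ∈ h.map (LinearMap.fst ℝ _ _) := by
  rw [Submodule.mem_map] at ha hb ⊢
  obtain ⟨u, hu, rfl⟩ := ha
  obtain ⟨w, hw, rfl⟩ := hb
  exact ⟨bracket u w, hh u hu w hw, rfl⟩

/-- The projection to the second factor is a subalgebra of `so(3)`. [folklore] -/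
theorem cross_mem_map_snd (hh : ∀ u ∈ h, ∀ w ∈ h, bracket u w ∈ h)
    (a : Fin 3 → ℝ) (ha : a ∈ h.map (LinearMap.snd ℝ _ _)) (b : Fin 3 → ℝ)
    (hb : b ∈ h.map (LinearMap.snd ℝ _ _)) : a ⨯₃ b ∈ h.map (LinearMap.snd ℝ _ _) := by
  rw [Submodule.mem_map] at ha hb ⊢
  obtain ⟨u, hu, rfl⟩ := ha
  obtain ⟨w, hw, rfl⟩ := hb
  exact ⟨bracket u w, hh u hu w hw, rfl⟩

/-- The intersection with the first factor, `K₁ = {x | (x, 0) ∈ 𝔥}`, is an ideal of the first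
projection: `x × x' ∈ K₁` for `x ∈ K₁` and `x'` in the projection. [folklore] -/
theorem cross_mem_comap_inl (hh : ∀ u ∈ h, ∀ w ∈ h, bracket u w ∈ h)
    (a : Fin 3 → ℝ) (ha : a ∈ h.comap (LinearMap.inl ℝ _ _)) (b : Fin 3 → ℝ)
    (hb : b ∈ h.map (LinearMap.fst ℝ _ _)) : a ⨯₃ b ∈ h.comap (LinearMap.inl ℝ _ _) := by
  rw [Submodule.mem_comap] at ha ⊢
  rw [Submodule.mem_map] at hb
  obtain ⟨w, hw, rfl⟩ := hb
  have := hh _ ha w hw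
  simpa [bracket] using this

/-- Likewise `K₂ = {y | (0, y) ∈ 𝔥}` is an ideal of the second projection. [folklore] -/
theorem cross_mem_comap_inr (hh : ∀ u ∈ h, ∀ w ∈ h, bracket u w ∈ h)
    (a : Fin 3 → ℝ) (ha : a ∈ h.comap (LinearMap.inr ℝ _ _)) (b : Fin 3 → ℝ)
    (hb : b ∈ h.map (LinearMap.snd ℝ _ _)) : a ⨯₃ b ∈ h.comap (LinearMap.inr ℝ _ _) := by
  rw [Submodule.mem_comap] at ha ⊢
  rw [Submodule.mem_map] at hb
  obtain ⟨w, hw, rfl⟩ := hb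
  have := hh _ ha w hw
  simpa [bracket] using this

/-- `K₁` lies in the first projection. [folklore] -/
theorem comap_inl_le_map_fst : h.comap (LinearMap.inl ℝ _ _) ≤ h.map (LinearMap.fst ℝ _ _) := by
  intro x hx
  rw [Submodule.mem_comap] at hx
  exact Submodule.mem_map.2 ⟨_, hx, rfl⟩

/-- `K₂` lies in the second projection. [folklore] -/
theorem comap_inr_le_map_snd : h.comap (LinearMap.inr ℝ _ _) ≤ h.map (LinearMap.snd ℝ _ _) := by
  intro x hx
  rw [Submodule.mem_comap] at hx
  exact Submodule.mem_map.2 ⟨_, hx, rfl⟩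

variable (h) in
/-- **Rank–nullity for the first projection**: `dim 𝔥 = dim π₁(𝔥) + dim K₂`, where
`K₂ = {y | (0, y) ∈ 𝔥}` is the kernel of the projection. [folklore] -/
theorem finrank_eq_finrank_map_fst_add :
    finrank ℝ h = finrank ℝ (h.map (LinearMap.fst ℝ _ _)) +
      finrank ℝ (h.comap (LinearMap.inr ℝ (Fin 3 → ℝ) (Fin 3 → ℝ))) := by
  set f : h →ₗ[ℝ] (Fin 3 → ℝ) := (LinearMap.fst ℝ _ _).comp h.subtype with hf
  have hrange : LinearMap.range f = h.map (LinearMap.fst ℝ _ _) := by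
    rw [hf, LinearMap.range_comp, Submodule.range_subtype]
  -- the kernel of `f` is isomorphic to `K₂` through the second component
  set g : LinearMap.ker f →ₗ[ℝ] (Fin 3 → ℝ) :=
    (LinearMap.snd ℝ _ _).comp (h.subtype.comp (LinearMap.ker f).subtype) with hg
  have hg_apply : ∀ u : LinearMap.ker f, g u = ((u : h) : (Fin 3 → ℝ) × (Fin 3 → ℝ)).2 :=
    fun u ↦ rfl
  have hf_apply : ∀ u : h, f u = (u : (Fin 3 → ℝ) × (Fin 3 → ℝ)).1 := fun u ↦ rfl
  have hginj : Function.Injective g := by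
    intro u u' huu
    rw [hg_apply, hg_apply] at huu
    have h1 : ((u : h) : (Fin 3 → ℝ) × (Fin 3 → ℝ)).1 = 0 := by
      have := u.2; rwa [LinearMap.mem_ker, hf_apply] at this
    have h1' : ((u' : h) : (Fin 3 → ℝ) × (Fin 3 → ℝ)).1 = 0 := by
      have := u'.2; rwa [LinearMap.mem_ker, hf_apply] at this
    apply Subtype.ext
    apply Subtype.ext
    exact Prod.ext (h1.trans h1'.symm) huu
  have hgrange : LinearMap.range g = h.comap (LinearMap.inr ℝ _ _) := by
    ext y
    rw [LinearMap.mem_range, Submodule.mem_comap]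
    constructor
    · rintro ⟨u, rfl⟩
      rw [hg_apply]
      have h1 : ((u : h) : (Fin 3 → ℝ) × (Fin 3 → ℝ)).1 = 0 := by
        have := u.2; rwa [LinearMap.mem_ker, hf_apply] at this
      have : ((u : h) : (Fin 3 → ℝ) × (Fin 3 → ℝ)) =
          (LinearMap.inr ℝ _ _) ((u : h) : (Fin 3 → ℝ) × (Fin 3 → ℝ)).2 := by
        ext1
        · simpa using h1
        · rfl
      rw [← this]
      exact (u : h).2
    · intro hy
      refine ⟨⟨⟨(0, y), hy⟩, ?_⟩, rfl⟩
      rw [LinearMap.mem_ker, hf_apply]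
  have hker : finrank ℝ (LinearMap.ker f) = finrank ℝ (h.comap (LinearMap.inr ℝ _ _)) := by
    rw [← hgrange, LinearMap.finrank_range_of_inj hginj]
  have := LinearMap.finrank_range_add_finrank_ker f
  rw [hrange, hker] at this
  exact this.symm

variable (h) in
/-- **Rank–nullity for the second projection**: `dim 𝔥 = dim π₂(𝔥) + dim K₁`. [folklore] -/
theorem finrank_eq_finrank_map_snd_add :
    finrank ℝ h = finrank ℝ (h.map (LinearMap.snd ℝ _ _)) +
      finrank ℝ (h.comap (LinearMap.inl ℝ (Fin 3 → ℝ) (Fin 3 → ℝ))) := by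
  set f : h →ₗ[ℝ] (Fin 3 → ℝ) := (LinearMap.snd ℝ _ _).comp h.subtype with hf
  have hrange : LinearMap.range f = h.map (LinearMap.snd ℝ _ _) := by
    rw [hf, LinearMap.range_comp, Submodule.range_subtype]
  set g : LinearMap.ker f →ₗ[ℝ] (Fin 3 → ℝ) :=
    (LinearMap.fst ℝ _ _).comp (h.subtype.comp (LinearMap.ker f).subtype) with hg
  have hg_apply : ∀ u : LinearMap.ker f, g u = ((u : h) : (Fin 3 → ℝ) × (Fin 3 → ℝ)).1 :=
    fun u ↦ rfl
  have hf_apply : ∀ u : h, f u = (u : (Fin 3 → ℝ) × (Fin 3 → ℝ)).2 := fun u ↦ rfl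
  have hginj : Function.Injective g := by
    intro u u' huu
    rw [hg_apply, hg_apply] at huu
    have h1 : ((u : h) : (Fin 3 → ℝ) × (Fin 3 → ℝ)).2 = 0 := by
      have := u.2; rwa [LinearMap.mem_ker, hf_apply] at this
    have h1' : ((u' : h) : (Fin 3 → ℝ) × (Fin 3 → ℝ)).2 = 0 := by
      have := u'.2; rwa [LinearMap.mem_ker, hf_apply] at this
    apply Subtype.ext
    apply Subtype.ext
    exact Prod.ext huu (h1.trans h1'.symm)
  have hgrange : LinearMap.range g = h.comap (LinearMap.inl ℝ _ _) := by
    ext y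
    rw [LinearMap.mem_range, Submodule.mem_comap]
    constructor
    · rintro ⟨u, rfl⟩
      rw [hg_apply]
      have h1 : ((u : h) : (Fin 3 → ℝ) × (Fin 3 → ℝ)).2 = 0 := by
        have := u.2; rwa [LinearMap.mem_ker, hf_apply] at this
      have : ((u : h) : (Fin 3 → ℝ) × (Fin 3 → ℝ)) =
          (LinearMap.inl ℝ _ _) ((u : h) : (Fin 3 → ℝ) × (Fin 3 → ℝ)).1 := by
        ext1
        · rfl
        · simpa using h1
      rw [← this]
      exact (u : h).2
    · intro hy
      refine ⟨⟨⟨(y, 0), hy⟩, ?_⟩, rfl⟩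
      rw [LinearMap.mem_ker, hf_apply]
  have hker : finrank ℝ (LinearMap.ker f) = finrank ℝ (h.comap (LinearMap.inl ℝ _ _)) := by
    rw [← hgrange, LinearMap.finrank_range_of_inj hginj]
  have := LinearMap.finrank_range_add_finrank_ker f
  rw [hrange, hker] at this
  exact this.symm

/-- **`so(3) × so(3)` has no five-dimensional subalgebra** (so that Hamilton's list of §9, p. 178,
of the holonomy algebras by dimension `0, 1, 2, 3, 4, 6` is exhaustive): `dim 𝔥 = dim π₁(𝔥) +
dim K₂` with both summands in `{0, 1, 3}`. [cite: Hamilton1986, §9, p. 178] -/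
theorem finrank_ne_five (hh : ∀ u ∈ h, ∀ w ∈ h, bracket u w ∈ h) : finrank ℝ h ≠ 5 := by
  have e := finrank_eq_finrank_map_fst_add h
  have hp := finrank_eq_zero_or_one_or_three_of_cross_mem _ (cross_mem_map_fst hh)
  have hk := finrank_eq_zero_or_one_or_three_of_cross_mem (h.comap (LinearMap.inr ℝ _ _))
    (fun a ha b hb ↦ cross_mem_comap_inr hh a ha b (comap_inr_le_map_snd hb))
  omega

/-- **Four-dimensional subalgebras contain a factor** (Hamilton 1986, §9, case 5, p. 179: "It
follows that `so(3)` maps to one factor in `so(3) × so(3)` and `so(2)` maps into the other"): if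
`dim 𝔥 = 4` then `so(3) × 0 ⊂ 𝔥` or `0 × so(3) ⊂ 𝔥`. [cite: Hamilton1986, §9, case 5 (p. 179)] -/
theorem fst_le_or_snd_le_of_finrank_eq_four (hh : ∀ u ∈ h, ∀ w ∈ h, bracket u w ∈ h)
    (h4 : finrank ℝ h = 4) : (∀ x : Fin 3 → ℝ, ((x, 0) : _ × _) ∈ h) ∨ ∀ y : Fin 3 → ℝ, ((0, y) : _ × _) ∈ h := by
  have e₁ := finrank_eq_finrank_map_fst_add h
  have e₂ := finrank_eq_finrank_map_snd_add h
  have hp₁ := finrank_eq_zero_or_one_or_three_of_cross_mem _ (cross_mem_map_fst hh)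
  have hp₂ := finrank_eq_zero_or_one_or_three_of_cross_mem _ (cross_mem_map_snd hh)
  have hk₁ := finrank_eq_zero_or_one_or_three_of_cross_mem (h.comap (LinearMap.inl ℝ _ _))
    (fun a ha b hb ↦ cross_mem_comap_inl hh a ha b (comap_inl_le_map_fst hb))
  have hk₂ := finrank_eq_zero_or_one_or_three_of_cross_mem (h.comap (LinearMap.inr ℝ _ _))
    (fun a ha b hb ↦ cross_mem_comap_inr hh a ha b (comap_inr_le_map_snd hb))
  -- `K₁ = ⊤` or `K₂ = ⊤`, for otherwise `K₂` (say) is a one-dimensional ideal of `π₂ = so(3)`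
  have top₁ : finrank ℝ (h.comap (LinearMap.inl ℝ (Fin 3 → ℝ) (Fin 3 → ℝ))) = 3 →
      ∀ x : Fin 3 → ℝ, ((x, 0) : _ × _) ∈ h := by
    intro h3 x
    have htop : h.comap (LinearMap.inl ℝ (Fin 3 → ℝ) (Fin 3 → ℝ)) = ⊤ :=
      Submodule.eq_top_of_finrank_eq (by rw [h3, finrank_fin_fun])
    have : x ∈ h.comap (LinearMap.inl ℝ (Fin 3 → ℝ) (Fin 3 → ℝ)) := by rw [htop]; trivial
    simpa using this
  have top₂ : finrank ℝ (h.comap (LinearMap.inr ℝ (Fin 3 → ℝ) (Fin 3 → ℝ))) = 3 →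
      ∀ y : Fin 3 → ℝ, ((0, y) : _ × _) ∈ h := by
    intro h3 y
    have htop : h.comap (LinearMap.inr ℝ (Fin 3 → ℝ) (Fin 3 → ℝ)) = ⊤ :=
      Submodule.eq_top_of_finrank_eq (by rw [h3, finrank_fin_fun])
    have : y ∈ h.comap (LinearMap.inr ℝ (Fin 3 → ℝ) (Fin 3 → ℝ)) := by rw [htop]; trivial
    simpa using this
  rcases hk₁ with k0 | k1 | k3
  · omega
  · rcases hk₂ with l0 | l1 | l3
    · omega
    · -- `K₂` one-dimensional ideal of `π₂ = ⊤`: impossible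
      exfalso
      have hp3 : finrank ℝ (h.map (LinearMap.snd ℝ (Fin 3 → ℝ) (Fin 3 → ℝ))) = 3 := by omega
      have htop : h.map (LinearMap.snd ℝ (Fin 3 → ℝ) (Fin 3 → ℝ)) = ⊤ :=
        Submodule.eq_top_of_finrank_eq (by rw [hp3, finrank_fin_fun])
      refine false_of_finrank_eq_one_of_cross_mem _ l1 fun x hx y ↦ ?_
      exact cross_mem_comap_inr hh x hx y (by rw [htop]; trivial)
    · exact Or.inr (top₂ l3)
  · exact Or.inl (top₁ k3)

/-- **Three-dimensional subalgebras are a factor or the graph of an isometry** (Hamilton 1986, §9,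
case 4, p. 178: "`𝔤` cannot be just one factor of `so(3) × so(3)` by the Bianchi identity. In
fact, since any Lie algebra preserving map of `so(3)` to `so(3)` must be [an isometry] … we see
that `𝔤` embeds as `{φ + Pφ}` where `P` is an isometry of `Λ²₊` to `Λ²₋`"): if `dim 𝔥 = 3` then
`𝔥 = so(3) × 0`, or `𝔥 = 0 × so(3)`, or `𝔥 = {(x, P x)}` for a special orthogonal `P`.
[cite: Hamilton1986, §9, case 4 (p. 178)] -/
theorem eq_factor_or_graph_of_finrank_eq_three (hh : ∀ u ∈ h, ∀ w ∈ h, bracket u w ∈ h)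
    (h3 : finrank ℝ h = 3) :
    (∀ u : (Fin 3 → ℝ) × (Fin 3 → ℝ), u ∈ h ↔ u.2 = 0) ∨
      (∀ u : (Fin 3 → ℝ) × (Fin 3 → ℝ), u ∈ h ↔ u.1 = 0) ∨
        ∃ P : (Fin 3 → ℝ) →ₗ[ℝ] (Fin 3 → ℝ), (∀ a b, P a ⬝ᵥ P b = a ⬝ᵥ b) ∧
          LinearMap.det P = 1 ∧ ∀ u : (Fin 3 → ℝ) × (Fin 3 → ℝ), u ∈ h ↔ u.2 = P u.1 := by
  have e₁ := finrank_eq_finrank_map_fst_add h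
  have e₂ := finrank_eq_finrank_map_snd_add h
  have hp₁ := finrank_eq_zero_or_one_or_three_of_cross_mem _ (cross_mem_map_fst hh)
  have hp₂ := finrank_eq_zero_or_one_or_three_of_cross_mem _ (cross_mem_map_snd hh)
  have hk₁ := finrank_eq_zero_or_one_or_three_of_cross_mem (h.comap (LinearMap.inl ℝ _ _))
    (fun a ha b hb ↦ cross_mem_comap_inl hh a ha b (comap_inl_le_map_fst hb))
  have hk₂ := finrank_eq_zero_or_one_or_three_of_cross_mem (h.comap (LinearMap.inr ℝ _ _))
    (fun a ha b hb ↦ cross_mem_comap_inr hh a ha b (comap_inr_le_map_snd hb))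
  -- case `K₁ = ⊤`: `𝔥 = so(3) × 0`
  by_cases c₁ : finrank ℝ (h.comap (LinearMap.inl ℝ (Fin 3 → ℝ) (Fin 3 → ℝ))) = 3
  · left
    have htop : h.comap (LinearMap.inl ℝ (Fin 3 → ℝ) (Fin 3 → ℝ)) = ⊤ :=
      Submodule.eq_top_of_finrank_eq (by rw [c₁, finrank_fin_fun])
    have hx : ∀ x : Fin 3 → ℝ, ((x, 0) : _ × _) ∈ h := fun x ↦ by
      have : x ∈ h.comap (LinearMap.inl ℝ (Fin 3 → ℝ) (Fin 3 → ℝ)) := by rw [htop]; trivial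
      simpa using this
    -- `π₂ = 0`
    have hp0 : finrank ℝ (h.map (LinearMap.snd ℝ (Fin 3 → ℝ) (Fin 3 → ℝ))) = 0 := by omega
    have hbot : h.map (LinearMap.snd ℝ (Fin 3 → ℝ) (Fin 3 → ℝ)) = ⊥ :=
      Submodule.finrank_eq_zero.1 hp0
    intro u
    constructor
    · intro hu
      have : u.2 ∈ h.map (LinearMap.snd ℝ (Fin 3 → ℝ) (Fin 3 → ℝ)) :=
        Submodule.mem_map.2 ⟨u, hu, rfl⟩
      rw [hbot] at this
      simpa using this
    · intro hu
      have : u = ((u.1, 0) : _ × _) := Prod.ext rfl hu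
      rw [this]
      exact hx u.1
  by_cases c₂ : finrank ℝ (h.comap (LinearMap.inr ℝ (Fin 3 → ℝ) (Fin 3 → ℝ))) = 3
  · right; left
    have htop : h.comap (LinearMap.inr ℝ (Fin 3 → ℝ) (Fin 3 → ℝ)) = ⊤ :=
      Submodule.eq_top_of_finrank_eq (by rw [c₂, finrank_fin_fun])
    have hy : ∀ y : Fin 3 → ℝ, ((0, y) : _ × _) ∈ h := fun y ↦ by
      have : y ∈ h.comap (LinearMap.inr ℝ (Fin 3 → ℝ) (Fin 3 → ℝ)) := by rw [htop]; trivial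
      simpa using this
    have hp0 : finrank ℝ (h.map (LinearMap.fst ℝ (Fin 3 → ℝ) (Fin 3 → ℝ))) = 0 := by omega
    have hbot : h.map (LinearMap.fst ℝ (Fin 3 → ℝ) (Fin 3 → ℝ)) = ⊥ :=
      Submodule.finrank_eq_zero.1 hp0
    intro u
    constructor
    · intro hu
      have : u.1 ∈ h.map (LinearMap.fst ℝ (Fin 3 → ℝ) (Fin 3 → ℝ)) :=
        Submodule.mem_map.2 ⟨u, hu, rfl⟩
      rw [hbot] at this
      simpa using this
    · intro hu
      have : u = ((0, u.2) : _ × _) := Prod.ext hu rfl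
      rw [this]
      exact hy u.2
  -- remaining case: `K₁ = K₂ = 0`, `π₁ = π₂ = so(3)`; `𝔥` is a graph
  right; right
  have k₁0 : finrank ℝ (h.comap (LinearMap.inl ℝ (Fin 3 → ℝ) (Fin 3 → ℝ))) = 0 := by omega
  have k₂0 : finrank ℝ (h.comap (LinearMap.inr ℝ (Fin 3 → ℝ) (Fin 3 → ℝ))) = 0 := by omega
  have p₁3 : finrank ℝ (h.map (LinearMap.fst ℝ (Fin 3 → ℝ) (Fin 3 → ℝ))) = 3 := by omega
  have K₁bot : h.comap (LinearMap.inl ℝ (Fin 3 → ℝ) (Fin 3 → ℝ)) = ⊥ :=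
    Submodule.finrank_eq_zero.1 k₁0
  have K₂bot : h.comap (LinearMap.inr ℝ (Fin 3 → ℝ) (Fin 3 → ℝ)) = ⊥ :=
    Submodule.finrank_eq_zero.1 k₂0
  have π₁top : h.map (LinearMap.fst ℝ (Fin 3 → ℝ) (Fin 3 → ℝ)) = ⊤ :=
    Submodule.eq_top_of_finrank_eq (by rw [p₁3, finrank_fin_fun])
  -- the first projection restricted to `𝔥` is a linear isomorphism
  set f : h →ₗ[ℝ] (Fin 3 → ℝ) := (LinearMap.fst ℝ _ _).comp h.subtype with hf
  have hf_apply : ∀ u : h, f u = (u : (Fin 3 → ℝ) × (Fin 3 → ℝ)).1 := fun u ↦ rfl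
  have hinj : Function.Injective f := by
    rw [← LinearMap.ker_eq_bot, Submodule.eq_bot_iff]
    intro u hu
    rw [LinearMap.mem_ker, hf_apply] at hu
    have h2 : (u : (Fin 3 → ℝ) × (Fin 3 → ℝ)).2 ∈
        h.comap (LinearMap.inr ℝ (Fin 3 → ℝ) (Fin 3 → ℝ)) := by
      rw [Submodule.mem_comap]
      have : (LinearMap.inr ℝ (Fin 3 → ℝ) (Fin 3 → ℝ)) (u : (Fin 3 → ℝ) × (Fin 3 → ℝ)).2 = u := by
        ext1
        · simpa using hu.symm
        · rfl
      rw [this]; exact u.2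
    rw [K₂bot, Submodule.mem_bot] at h2
    exact Subtype.ext (Prod.ext hu h2)
  have hsurj : Function.Surjective f := by
    rw [← LinearMap.range_eq_top, hf, LinearMap.range_comp, Submodule.range_subtype, π₁top]
  set F := LinearEquiv.ofBijective f ⟨hinj, hsurj⟩ with hF
  have hF_apply : ∀ u : h, F u = (u : (Fin 3 → ℝ) × (Fin 3 → ℝ)).1 := fun u ↦ rfl
  have hFsymm₁ : ∀ x, ((F.symm x : h) : (Fin 3 → ℝ) × (Fin 3 → ℝ)).1 = x := fun x ↦ by
    rw [← hF_apply, LinearEquiv.apply_symm_apply]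
  set P : (Fin 3 → ℝ) →ₗ[ℝ] (Fin 3 → ℝ) :=
    (LinearMap.snd ℝ _ _).comp (h.subtype.comp (F.symm : (Fin 3 → ℝ) →ₗ[ℝ] h)) with hP
  have hP_apply : ∀ x, P x = ((F.symm x : h) : (Fin 3 → ℝ) × (Fin 3 → ℝ)).2 := fun x ↦ rfl
  -- membership in `𝔥` is `u.2 = P u.1`
  have hmem : ∀ u : (Fin 3 → ℝ) × (Fin 3 → ℝ), u ∈ h ↔ u.2 = P u.1 := by
    intro u
    constructor
    · intro hu
      have : F.symm u.1 = ⟨u, hu⟩ := by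
        apply F.injective
        rw [LinearEquiv.apply_symm_apply, hF_apply]
      rw [hP_apply, this]
    · intro hu
      have e : u = ((F.symm u.1 : h) : (Fin 3 → ℝ) × (Fin 3 → ℝ)) :=
        Prod.ext (hFsymm₁ u.1).symm (by rw [hu, hP_apply])
      rw [e]
      exact (F.symm u.1).2
  -- `P` preserves the cross product
  have hPcross : ∀ a b, P (a ⨯₃ b) = P a ⨯₃ P b := by
    intro a b
    have ha : ((a, P a) : _ × _) ∈ h := (hmem _).2 rfl
    have hb : ((b, P b) : _ × _) ∈ h := (hmem _).2 rfl
    have := (hmem _).1 (hh _ ha _ hb)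
    simpa [bracket] using this.symm
  rcases eq_zero_or_isometry_of_map_cross P hPcross with hP0 | ⟨hiso, hdet⟩
  · -- `P = 0` would make `𝔥 = so(3) × 0`, excluded (`K₁ = 0`)
    exfalso
    have hx : ((Pi.single 0 1, 0) : (Fin 3 → ℝ) × (Fin 3 → ℝ)) ∈ h := by
      rw [hmem, hP0]; rfl
    have : (Pi.single 0 1 : Fin 3 → ℝ) ∈ h.comap (LinearMap.inl ℝ (Fin 3 → ℝ) (Fin 3 → ℝ)) := by
      simpa using hx
    rw [K₁bot, Submodule.mem_bot] at this
    have h00 : (Pi.single 0 1 : Fin 3 → ℝ) 0 = 0 := by rw [this]; rfl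
    simp at h00
  · exact ⟨P, hiso, hdet, hmem⟩

/-- **Two-dimensional subalgebras split** (Hamilton 1986, §9, case 3, p. 178: "In this case there
are two invariant 2-forms `φ ∈ Λ²₊` and `ψ ∈ Λ²₋`"): if `dim 𝔥 = 2` then
`𝔥 = ℝ(φ, 0) ⊕ ℝ(0, ψ)` for non-zero `φ`, `ψ ∈ ℝ³`. [cite: Hamilton1986, §9, case 3 (p. 178)] -/
theorem eq_span_pair_of_finrank_eq_two (hh : ∀ u ∈ h, ∀ w ∈ h, bracket u w ∈ h)
    (h2 : finrank ℝ h = 2) :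
    ∃ φ ψ : Fin 3 → ℝ, φ ≠ 0 ∧ ψ ≠ 0 ∧
      ∀ u : (Fin 3 → ℝ) × (Fin 3 → ℝ), u ∈ h ↔ ∃ s t : ℝ, u = (s • φ, t • ψ) := by
  have e₁ := finrank_eq_finrank_map_fst_add h
  have e₂ := finrank_eq_finrank_map_snd_add h
  have hp₁ := finrank_eq_zero_or_one_or_three_of_cross_mem _ (cross_mem_map_fst hh)
  have hp₂ := finrank_eq_zero_or_one_or_three_of_cross_mem _ (cross_mem_map_snd hh)
  have hk₁ := finrank_eq_zero_or_one_or_three_of_cross_mem (h.comap (LinearMap.inl ℝ _ _))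
    (fun a ha b hb ↦ cross_mem_comap_inl hh a ha b (comap_inl_le_map_fst hb))
  have hk₂ := finrank_eq_zero_or_one_or_three_of_cross_mem (h.comap (LinearMap.inr ℝ _ _))
    (fun a ha b hb ↦ cross_mem_comap_inr hh a ha b (comap_inr_le_map_snd hb))
  have hK₁le : finrank ℝ (h.comap (LinearMap.inl ℝ (Fin 3 → ℝ) (Fin 3 → ℝ))) ≤
      finrank ℝ (h.map (LinearMap.fst ℝ (Fin 3 → ℝ) (Fin 3 → ℝ))) :=
    Submodule.finrank_mono comap_inl_le_map_fst
  have hK₂le : finrank ℝ (h.comap (LinearMap.inr ℝ (Fin 3 → ℝ) (Fin 3 → ℝ))) ≤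
      finrank ℝ (h.map (LinearMap.snd ℝ (Fin 3 → ℝ) (Fin 3 → ℝ))) :=
    Submodule.finrank_mono comap_inr_le_map_snd
  have k₁1 : finrank ℝ (h.comap (LinearMap.inl ℝ (Fin 3 → ℝ) (Fin 3 → ℝ))) = 1 := by omega
  have k₂1 : finrank ℝ (h.comap (LinearMap.inr ℝ (Fin 3 → ℝ) (Fin 3 → ℝ))) = 1 := by omega
  obtain ⟨⟨φ, hφK⟩, hφ0, -⟩ := finrank_eq_one_iff'.1 k₁1
  obtain ⟨⟨ψ, hψK⟩, hψ0, -⟩ := finrank_eq_one_iff'.1 k₂1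
  have hφ : φ ≠ 0 := fun e ↦ hφ0 (Subtype.ext e)
  have hψ : ψ ≠ 0 := fun e ↦ hψ0 (Subtype.ext e)
  have hφh : ((φ, 0) : (Fin 3 → ℝ) × (Fin 3 → ℝ)) ∈ h := by simpa using hφK
  have hψh : ((0, ψ) : (Fin 3 → ℝ) × (Fin 3 → ℝ)) ∈ h := by simpa using hψK
  refine ⟨φ, ψ, hφ, hψ, ?_⟩
  -- the span of `(φ, 0)` and `(0, ψ)` is a two-dimensional subspace of `𝔥`, hence all of it
  set S : Submodule ℝ ((Fin 3 → ℝ) × (Fin 3 → ℝ)) :=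
    Submodule.span ℝ (Set.range ![((φ, 0) : _ × _), ((0, ψ) : _ × _)]) with hS
  have hli : LinearIndependent ℝ ![((φ, 0) : (Fin 3 → ℝ) × (Fin 3 → ℝ)), ((0, ψ) : _ × _)] := by
    rw [LinearIndependent.pair_iff]
    intro s t hst
    simp only [Prod.smul_mk, smul_zero, Prod.mk_add_mk, add_zero, zero_add,
      Prod.mk_eq_zero] at hst
    exact ⟨(smul_eq_zero.1 hst.1).resolve_right hφ, (smul_eq_zero.1 hst.2).resolve_right hψ⟩
  have hSle : S ≤ h := by
    rw [hS, Submodule.span_le]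
    rintro _ ⟨i, rfl⟩
    fin_cases i
    · exact hφh
    · exact hψh
  have hS2 : finrank ℝ S = 2 := by
    rw [hS, finrank_span_eq_card hli]
    rfl
  have hSeq : S = h := Submodule.eq_of_le_of_finrank_eq hSle (by rw [hS2, h2])
  intro u
  constructor
  · intro hu
    rw [← hSeq, hS, Submodule.mem_span_range_iff_exists_fun] at hu
    obtain ⟨c, hc⟩ := hu
    refine ⟨c 0, c 1, ?_⟩
    rw [← hc]
    simp [Fin.sum_univ_two]
  · rintro ⟨s, t, rfl⟩
    have : ((s • φ, t • ψ) : (Fin 3 → ℝ) × (Fin 3 → ℝ)) = s • ((φ, 0) : _ × _) + t • ((0, ψ) : _ × _) := by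
      simp
    rw [this]
    exact h.add_mem (h.smul_mem s hφh) (h.smul_mem t hψh)

end Subalgebras

/-! ### Hamilton's list of cases for the image of the curvature operator (§9, p. 178) -/

section CaseList

open Module

variable {p : Blocks}

/-- `dim (Λ²₊ ⊕ Λ²₋) = 6`. [folklore] -/
theorem finrank_blocksVec : finrank ℝ ((Fin 3 → ℝ) × (Fin 3 → ℝ)) = 6 := by
  rw [Module.finrank_prod, finrank_fin_fun]

/-- The image of `M` is closed under the bracket (Thm. 8.3, pointwise, `bracket_mem_range_act`),
as a statement about the submodule `LinearMap.range (actₗ p)`.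
[cite: Hamilton1986, §8, Thm. 8.3 (p. 176)] -/
theorem bracket_mem_range_actₗ (hA : p.1.IsSymm) (hC : p.2.2.IsSymm) (hpos : ∀ v, 0 ≤ quad p v)
    (hnull : ∀ v, act p v = 0 → sharpQuad p v = 0) :
    ∀ u ∈ LinearMap.range (actₗ p), ∀ w ∈ LinearMap.range (actₗ p),
      bracket u w ∈ LinearMap.range (actₗ p) := by
  intro u hu w hw
  rw [mem_range_actₗ_iff] at hu hw ⊢
  exact bracket_mem_range_act hA hC hpos hnull hu hw

/-- **The rank of `M` is not `5`** (for `M ≥ 0` with `null M ⊂ null M^#`): its image is a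
subalgebra of `so(3) × so(3)` (`finrank_ne_five`). [cite: Hamilton1986, §9, p. 178] -/
theorem finrank_range_actₗ_ne_five (hA : p.1.IsSymm) (hC : p.2.2.IsSymm)
    (hpos : ∀ v, 0 ≤ quad p v) (hnull : ∀ v, act p v = 0 → sharpQuad p v = 0) :
    finrank ℝ (LinearMap.range (actₗ p)) ≠ 5 :=
  finrank_ne_five (bracket_mem_range_actₗ hA hC hpos hnull)

/-- If the image of `M` is trivial then `M = 0`. [folklore] -/
theorem eq_zero_of_finrank_range_actₗ_eq_zero (h0 : finrank ℝ (LinearMap.range (actₗ p)) = 0) :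
    p = 0 := by
  have hbot : LinearMap.range (actₗ p) = ⊥ := Submodule.finrank_eq_zero.1 h0
  rw [LinearMap.range_eq_bot] at hbot
  exact eq_zero_of_forall_act_eq_zero fun v ↦ by
    have := LinearMap.congr_fun hbot v
    simpa using this

/-- If the image of `M ≥ 0` is everything then `M > 0`: `M(v, v) > 0` for `v ≠ 0`. [folklore] -/
theorem quad_pos_of_finrank_range_actₗ_eq_six (hA : p.1.IsSymm) (hC : p.2.2.IsSymm)
    (hpos : ∀ v, 0 ≤ quad p v) (h6 : finrank ℝ (LinearMap.range (actₗ p)) = 6)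
    {v : (Fin 3 → ℝ) × (Fin 3 → ℝ)} (hv : v ≠ 0) : 0 < quad p v := by
  have htop : LinearMap.range (actₗ p) = ⊤ :=
    Submodule.eq_top_of_finrank_eq (by rw [h6, finrank_blocksVec])
  have hinj : Function.Injective (actₗ p) :=
    LinearMap.injective_iff_surjective.2 (LinearMap.range_eq_top.1 htop)
  refine lt_of_le_of_ne (hpos v) fun h0 ↦ hv ?_
  have hact : act p v = 0 := (act_eq_zero_iff_quad_eq_zero hA hC hpos v).2 h0.symm
  exact hinj (by simpa using hact)

/-- **Hamilton 1986, §9, "Here are the possibilities in dimension 4, classified by the holonomy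
group" (p. 178), as the algebraic case list for the curvature operator at a point.** Let
`M = (A B; ᵗB C)` be a block triple with `A`, `C` symmetric, `M ≥ 0`, `tr A = tr C` (Bianchi) and
`null M ⊂ null M^#` (the output of Lemma 8.2 / Thm. 8.3, printed convention), and let
`𝔤 = Im M ⊂ Λ²₊ ⊕ Λ²₋` (a Lie subalgebra, `bracket_mem_range_actₗ`). Then exactly as in the six
printed cases: (1) `M = 0` (`𝔤 = 0`, flat); or (2) `dim 𝔤 = 1`, `𝔤 = ℝ θ` with
`|θ₊|² = |θ₋|²` ("the image of `M` is spanned by a single two-form `φ`, and the Bianchi identity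
guarantees `φ` comes from a two-plane"); or (3) `dim 𝔤 = 2`, `𝔤 = ℝ(φ, 0) ⊕ ℝ(0, ψ)` ("two
invariant 2-forms `φ ∈ Λ²₊` and `ψ ∈ Λ²₋`"); or (4) `dim 𝔤 = 3`, `𝔤 = {(x, Px)}` for a special
orthogonal `P` ("`𝔤` embeds as `{φ + Pφ}` where `P` is an isometry of `Λ²₊` to `Λ²₋`"; the factors
`so(3) × 0`, `0 × so(3)` are excluded by `tr A = tr C`); or (5) `dim 𝔤 = 4` and `𝔤` contains
`so(3) × 0` or `0 × so(3)` ("`so(3)` maps to one factor … and `so(2)` maps into the other"); or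
(6) `M > 0` (`𝔤 = so(3) × so(3)`). There is no case `dim 𝔤 = 5` (`finrank_ne_five`).
[cite: Hamilton1986, §9, cases 1–6 (pp. 178–179)] -/
theorem hamilton_caseList (hA : p.1.IsSymm) (hC : p.2.2.IsSymm) (hpos : ∀ v, 0 ≤ quad p v)
    (htr : p.1.trace = p.2.2.trace) (hnull : ∀ v, act p v = 0 → sharpQuad p v = 0) :
    p = 0 ∨
    (finrank ℝ (LinearMap.range (actₗ p)) = 1 ∧
      ∃ θ : (Fin 3 → ℝ) × (Fin 3 → ℝ), θ ≠ 0 ∧ θ.1 ⬝ᵥ θ.1 = θ.2 ⬝ᵥ θ.2 ∧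
        ∀ u, u ∈ LinearMap.range (actₗ p) ↔ ∃ t : ℝ, u = t • θ) ∨
    (finrank ℝ (LinearMap.range (actₗ p)) = 2 ∧
      ∃ φ ψ : Fin 3 → ℝ, φ ≠ 0 ∧ ψ ≠ 0 ∧
        ∀ u, u ∈ LinearMap.range (actₗ p) ↔ ∃ s t : ℝ, u = (s • φ, t • ψ)) ∨
    (finrank ℝ (LinearMap.range (actₗ p)) = 3 ∧
      ∃ P : (Fin 3 → ℝ) →ₗ[ℝ] (Fin 3 → ℝ), (∀ a b, P a ⬝ᵥ P b = a ⬝ᵥ b) ∧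
        LinearMap.det P = 1 ∧ ∀ u, u ∈ LinearMap.range (actₗ p) ↔ u.2 = P u.1) ∨
    (finrank ℝ (LinearMap.range (actₗ p)) = 4 ∧
      ((∀ x : Fin 3 → ℝ, ((x, 0) : _ × _) ∈ LinearMap.range (actₗ p)) ∨
        ∀ y : Fin 3 → ℝ, ((0, y) : _ × _) ∈ LinearMap.range (actₗ p))) ∨
    (∀ v, v ≠ 0 → 0 < quad p v) := by
  have hh := bracket_mem_range_actₗ hA hC hpos hnull
  have hle : finrank ℝ (LinearMap.range (actₗ p)) ≤ 6 := by
    have := (LinearMap.range (actₗ p)).finrank_le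
    rwa [finrank_blocksVec] at this
  have h5 := finrank_range_actₗ_ne_five hA hC hpos hnull
  -- `M v ∈ Im M`
  have hmem : ∀ v, act p v ∈ LinearMap.range (actₗ p) := fun v ↦
    (mem_range_actₗ_iff _).2 ⟨v, rfl⟩
  rcases Nat.lt_or_ge (finrank ℝ (LinearMap.range (actₗ p))) 1 with h0 | h1
  · exact Or.inl (eq_zero_of_finrank_range_actₗ_eq_zero (by omega))
  rcases Nat.lt_or_ge (finrank ℝ (LinearMap.range (actₗ p))) 2 with h1' | h2
  · -- rank one
    right; left
    have hr1 : finrank ℝ (LinearMap.range (actₗ p)) = 1 := by omega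
    refine ⟨hr1, ?_⟩
    obtain ⟨⟨θ, hθmem⟩, hθ0, hgen⟩ := finrank_eq_one_iff'.1 hr1
    have hθ : θ ≠ 0 := fun e ↦ hθ0 (Subtype.ext e)
    have hline : ∀ u, u ∈ LinearMap.range (actₗ p) ↔ ∃ t : ℝ, u = t • θ := by
      intro u
      constructor
      · intro hu
        obtain ⟨t, ht⟩ := hgen ⟨u, hu⟩
        exact ⟨t, by simpa using congrArg Subtype.val ht.symm⟩
      · rintro ⟨t, rfl⟩
        exact Submodule.smul_mem _ t hθmem
    have hφ : ∀ v, ∃ t : ℝ, act p v = t • θ := fun v ↦ (hline _).1 (hmem v)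
    have hp : p ≠ 0 := by
      rintro rfl
      have : LinearMap.range (actₗ (0 : Blocks)) = ⊥ := by
        rw [LinearMap.range_eq_bot]
        ext v <;> simp [act]
      rw [this, finrank_bot] at hr1
      exact zero_ne_one hr1
    exact ⟨θ, hθ, dotProduct_self_fst_eq_snd_of_range_subset_line hA hC hpos htr hp hφ, hline⟩
  rcases Nat.lt_or_ge (finrank ℝ (LinearMap.range (actₗ p))) 3 with h2' | h3
  · -- rank two
    right; right; left
    have hr2 : finrank ℝ (LinearMap.range (actₗ p)) = 2 := by omega
    exact ⟨hr2, eq_span_pair_of_finrank_eq_two hh hr2⟩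
  rcases Nat.lt_or_ge (finrank ℝ (LinearMap.range (actₗ p))) 4 with h3' | h4
  · -- rank three: the factors are excluded by `tr A = tr C`
    right; right; right; left
    have hr3 : finrank ℝ (LinearMap.range (actₗ p)) = 3 := by omega
    refine ⟨hr3, ?_⟩
    rcases eq_factor_or_graph_of_finrank_eq_three hh hr3 with hf | hf | hgraph
    · exfalso
      have hp0 : p = 0 := eq_zero_of_forall_act_snd_eq_zero hA hC hpos htr
        fun v ↦ (hf _).1 (hmem v)
      subst hp0
      have : LinearMap.range (actₗ (0 : Blocks)) = ⊥ := by
        rw [LinearMap.range_eq_bot]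
        ext v <;> simp [act]
      rw [this, finrank_bot] at hr3
      exact absurd hr3 (by norm_num)
    · exfalso
      have hp0 : p = 0 := eq_zero_of_forall_act_fst_eq_zero hA hC hpos htr
        fun v ↦ (hf _).1 (hmem v)
      subst hp0
      have : LinearMap.range (actₗ (0 : Blocks)) = ⊥ := by
        rw [LinearMap.range_eq_bot]
        ext v <;> simp [act]
      rw [this, finrank_bot] at hr3
      exact absurd hr3 (by norm_num)
    · exact hgraph
  rcases Nat.lt_or_ge (finrank ℝ (LinearMap.range (actₗ p))) 5 with h4' | h5'
  · -- rank four
    right; right; right; right; left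
    have hr4 : finrank ℝ (LinearMap.range (actₗ p)) = 4 := by omega
    exact ⟨hr4, fst_le_or_snd_le_of_finrank_eq_four hh hr4⟩
  · -- rank six
    right; right; right; right; right
    have hr6 : finrank ℝ (LinearMap.range (actₗ p)) = 6 := by omega
    exact fun v hv ↦ quad_pos_of_finrank_range_actₗ_eq_six hA hC hpos hr6 hv

/-- **The case list in the frame convention of `CurvatureDecomposition.lean`** (the tree's
`blockA/B/C`; true reaction term `(A² + BᵗB + 2A^#, AB + BC - 2B^#, C² + ᵗBB + 2C^#)`,
`reflectB_field_reflectB`): the same six cases for `M = (A B; ᵗB C) ≥ 0`, `A`, `C` symmetric,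
`tr A = tr C`, whose null space is killed by the Lie square OF THAT CONVENTION,
`M v = 0 ⇒ ᵗx A^# x - 2 ᵗx B^# y + ᵗy C^# y = 0` (`sharpQuad p (flipSnd v)`), obtained from
`hamilton_caseList` for `reflectB p` through the reflection `(x, y) ↦ (x, -y)`
(`range_act_reflectB`, `finrank_range_actₗ_reflectB`); the only visible change is that the graph
isometry of case 4 has determinant `-1` (e.g. `Λ²(e₀^⊥) = {x + y = 0}`, the graph of `-1`).
[cite: Hamilton1986, §9, cases 1–6 (pp. 178–179)] -/
theorem hamilton_caseList_frame (hA : p.1.IsSymm) (hC : p.2.2.IsSymm) (hpos : ∀ v, 0 ≤ quad p v)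
    (htr : p.1.trace = p.2.2.trace) (hnull : ∀ v, act p v = 0 → sharpQuad p (flipSnd v) = 0) :
    p = 0 ∨
    (finrank ℝ (LinearMap.range (actₗ p)) = 1 ∧
      ∃ θ : (Fin 3 → ℝ) × (Fin 3 → ℝ), θ ≠ 0 ∧ θ.1 ⬝ᵥ θ.1 = θ.2 ⬝ᵥ θ.2 ∧
        ∀ u, u ∈ LinearMap.range (actₗ p) ↔ ∃ t : ℝ, u = t • θ) ∨
    (finrank ℝ (LinearMap.range (actₗ p)) = 2 ∧
      ∃ φ ψ : Fin 3 → ℝ, φ ≠ 0 ∧ ψ ≠ 0 ∧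
        ∀ u, u ∈ LinearMap.range (actₗ p) ↔ ∃ s t : ℝ, u = (s • φ, t • ψ)) ∨
    (finrank ℝ (LinearMap.range (actₗ p)) = 3 ∧
      ∃ P : (Fin 3 → ℝ) →ₗ[ℝ] (Fin 3 → ℝ), (∀ a b, P a ⬝ᵥ P b = a ⬝ᵥ b) ∧
        LinearMap.det P = -1 ∧ ∀ u, u ∈ LinearMap.range (actₗ p) ↔ u.2 = P u.1) ∨
    (finrank ℝ (LinearMap.range (actₗ p)) = 4 ∧
      ((∀ x : Fin 3 → ℝ, ((x, 0) : _ × _) ∈ LinearMap.range (actₗ p)) ∨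
        ∀ y : Fin 3 → ℝ, ((0, y) : _ × _) ∈ LinearMap.range (actₗ p))) ∨
    (∀ v, v ≠ 0 → 0 < quad p v) := by
  have hA' : (reflectB p).1.IsSymm := hA
  have hC' : (reflectB p).2.2.IsSymm := hC
  have H := hamilton_caseList hA' hC' ((quad_reflectB_nonneg_iff p).2 hpos)
    ((reflectB_trace_eq_iff p).2 htr) ((reflectB_null_iff p).2 hnull)
  -- the transfer of memberships and of the rank
  have hmemR : ∀ u, u ∈ LinearMap.range (actₗ p) ↔ flipSnd u ∈ LinearMap.range (actₗ (reflectB p)) := by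
    intro u
    rw [mem_range_actₗ_iff, mem_range_actₗ_iff, range_act_reflectB, flipSnd_flipSnd]
  have hrk := finrank_range_actₗ_reflectB p
  rcases H with h0 | ⟨h1, θ, hθ, hθθ, hline⟩ | ⟨h2, φ, ψ, hφ, hψ, hspan⟩ |
      ⟨h3, P, hiso, hdet, hgraph⟩ | ⟨h4, hfac⟩ | h6
  · left
    have := congrArg reflectB h0
    rw [reflectB_reflectB] at this
    rw [this]
    simp [reflectB]
  · right; left
    refine ⟨by rw [← hrk, h1], flipSnd θ, by rwa [Ne, flipSnd_eq_zero_iff], ?_, fun u ↦ ?_⟩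
    · obtain ⟨θ₁, θ₂⟩ := θ
      simpa [flipSnd] using hθθ
    · rw [hmemR, hline]
      constructor
      · rintro ⟨t, ht⟩
        refine ⟨t, ?_⟩
        have := congrArg flipSnd ht
        rwa [flipSnd_flipSnd, flipSnd_smul] at this
      · rintro ⟨t, rfl⟩
        exact ⟨t, by rw [flipSnd_smul, flipSnd_flipSnd]⟩
  · right; right; left
    refine ⟨by rw [← hrk, h2], φ, ψ, hφ, hψ, fun u ↦ ?_⟩
    rw [hmemR, hspan]
    obtain ⟨x, y⟩ := u
    simp only [flipSnd_mk, Prod.mk.injEq]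
    constructor
    · rintro ⟨s, t, hs, ht⟩
      exact ⟨s, -t, hs, by rw [neg_smul, ← ht, neg_neg]⟩
    · rintro ⟨s, t, hs, ht⟩
      exact ⟨s, -t, hs, by rw [ht, neg_smul]⟩
  · right; right; right; left
    refine ⟨by rw [← hrk, h3], -P, fun a b ↦ ?_, ?_, fun u ↦ ?_⟩
    · simp only [LinearMap.neg_apply, neg_dotProduct, dotProduct_neg, neg_neg]
      exact hiso a b
    · have e : -P = (-1 : ℝ) • P := (neg_one_smul ℝ P).symm
      rw [e, LinearMap.det_smul, hdet, finrank_fin_fun]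
      norm_num
    · rw [hmemR, hgraph]
      obtain ⟨x, y⟩ := u
      simp only [flipSnd_mk, LinearMap.neg_apply]
      constructor
      · intro h; rw [← h, neg_neg]
      · intro h; rw [h, neg_neg]
  · right; right; right; right; left
    refine ⟨by rw [← hrk, h4], ?_⟩
    rcases hfac with hx | hy
    · left
      intro x
      rw [hmemR]
      simpa using hx x
    · right
      intro y
      rw [hmemR]
      simpa using hy (-y)
  · right; right; right; right; right
    intro v hv
    have := h6 (flipSnd v) (by rwa [Ne, flipSnd_eq_zero_iff])
    rwa [quad_reflectB_flipSnd] at this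

end CaseList

end HamiltonODE

end Literature.Geometry.Riemannian

end
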